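import Summits.AtomisticToContinuum.HydrodynamicLimit.Theses.UGibbsSRBRigidity
import Summits.AtomisticToContinuum.HydrodynamicLimit.Theorems.TwoClocksEntropyToHydro

/-!
# Route UGibbsSRBRigidity — the `Assembly` item (stmt-AtomisticToContinuum-14646): reductions

`Assembly` is the chain `URegularLimitsSlaved → URigiditySlaved → GaussianTails →
_root_.HydrodynamicLimit` — the route's crux-only deciding theorem
`closes : URegularLimitsSlaved → URigiditySlaved → GaussianTails → GronwallU →
EntropyMethodTransfer → _root_.HydrodynamicLimit := fun h₁ h₂ h₃ hG hT => hT (hG h₁ h₂ h₃)`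
(rev 32; since rev 35 over the packing-guarded twins `GronwallUInBand`, `EntropyMethodTransferInBand`,
see the repair note) with its two glue hypotheses discharged. Of the two glue steps

* `EntropyMethodTransfer : RelEntropyVanishing → _root_.HydrodynamicLimit`
  (stmt-AtomisticToContinuum-9240) is PROVED here, unconditionally: the route's copy of the shared
  entropy target `RelEntropyVanishing` (stmt-AtomisticToContinuum-0766) is, binder for binder, the
  hypothesis of the tree's entropy-inequality glue
  `Theorems.hydrodynamicLimit_of_relEntropyVanishing` (file `TwoClocksEntropyToHydro.lean`:
  `μ(A)·L ≤ KL(μ‖ν) + (e^L − 1)·ν(A)`, the reference law's exponential concentration, and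
  `λ_N{z | Φ_N.flow t z ∈ A} ≤ ((Φ_N.flow t)_* λ_N)(A)`), whose conclusion is the unguarded Literature
  statement `Literature.MathematicalPhysics.KineticTheory.HydrodynamicLimit`, which implies the
  (since 2026-08-16 packing-guarded) sub-problem decl `_root_.HydrodynamicLimit`
  (`HydrodynamicLimit.of_unguarded`);
* `GronwallU : URegularLimitsSlaved → URigiditySlaved → GaussianTails → RelEntropyVanishing`
  (stmt-AtomisticToContinuum-14511, the relative-entropy Gronwall of Olla–Varadhan–Yau run for the
  deterministic hard-sphere flow with the true kinetic energy) is the entire remaining content: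
  `uGibbsSRBRigidity_assembly_of_gronwallU : GronwallU → Assembly` closes the item by the
  one-liner `uGibbsSRBRigidity_assembly_of_gronwallU gronwallU_proof` the moment stmt-14511 lands
  (a direct proof `hRE` of the shared target closes it equally, as
  `uGibbsSRBRigidity_assembly_of_gronwallU fun _ _ _ => hRE`, the three primary cruxes then being
  idle).

No other decomposition is claimed: modulo the proved transfer, `Assembly` and `GronwallU` differ
only in their last arrow (`_root_.HydrodynamicLimit` versus `RelEntropyVanishing`), so any proof of
`Assembly` from its three antecedents is a derivation of the Euler limit from u-regularity,
u-Gibbs rigidity and Gaussian tails — the content filed as stmt-14511.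

**Repair 2026-08-17 (fullbuild breakage "46:56: Unknown identifier `EntropyMethodTransfer`",
"57:54: Unknown identifier `GronwallU`").** The route repair of 2026-08-16T23:31Z (rev 35, after the
Statement re-type p126922 made `_root_.HydrodynamicLimit` the PACKING-GUARDED conjunct instead of the
root abbreviation of the Literature statement) dropped the route's declarations `RelEntropyVanishing`
(stmt-0766), `GronwallU` (stmt-14511) and `EntropyMethodTransfer` (stmt-9240) in favour of the guarded
twins `RelEntropyVanishingInBand` (stmt-17396), `GronwallUInBand` (stmt-17738),
`EntropyMethodTransferInBand` (stmt-17397), over which `closes` is now stated; `Assembly`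
(stmt-14646) is unchanged. The three dropped constants are therefore RE-DECLARED below in the route's
namespace, each with its item's ledger signature verbatim (definitions, not cited facts), solely so
that the three landed theorems keep their statements and keep elaborating (append-only Theorems; same
device as `CollisionIsometryCLTHsFreeEnergyConvexTransport.lean` and AnomalousDissipation's
`CoherentStatesAssembly2.lean`). Two proofs change, no statement does: the transfer now ends with
`HydrodynamicLimit.of_unguarded` (the re-typed conclusion is weaker than the Literature statement the
glue lemma delivers), and `uGibbsSRBRigidity_closes_of_gronwallU` is the term
`uGibbsSRBRigidity_entropyMethodTransfer_proof (hG h₁ h₂ h₃)` instead of an application of the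
re-typed `closes` (whose glue hypotheses are now the InBand twins). The InBand chain itself
(`GronwallUInBand`, `EntropyMethodTransferInBand`) is the business of items stmt-17738 / stmt-17397,
not of this file.
-/

namespace Summit.AtomisticToContinuum.HydrodynamicLimit.Theses.UGibbsSRBRigidity

/-- The shared Yau-form entropy target `RelEntropyVanishing` (item stmt-AtomisticToContinuum-0766) as
route `UGibbsSRBRigidity` declared it until its rev 35 (2026-08-16T23:31Z), ledger signature verbatim:
for all continuous positive profiles there is `σ₀` such that for `0 < σ < σ₀`, every classical
hard-sphere Euler solution on `[0, T)` and every flow family, the initial local Gibbs laws are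
probability measures and, if their empirical fields converge at `t = 0`, then for every `t < T` some
activity profile `a_t` makes the reference local Gibbs law `(a_t, u_t, θ_t)` a probability measure
whose density / momentum / energy fields concentrate exponentially around `(ρ, ρu, E)(t)` while
`KL(lawAt Φ_N λ_N t ‖ reference)/(N+1) → 0`. Re-declared here (a definition, not a cited fact) only to
keep the landed theorems below elaborating under their original statements; it is the same
proposition as the sibling routes' copies (e.g. `TwoClocks.RelEntropyVanishing`). -/
def RelEntropyVanishing : Prop :=
  ∀ (a₀ θ₀ : Literature.MathematicalPhysics.KineticTheory.T3 → ℝ) (u₀ : Literature.MathematicalPhysics.KineticTheory.T3 → Literature.MathematicalPhysics.KineticTheory.V3), Continuous a₀ → Continuous θ₀ → Continuous u₀ → (∀ x, 0 < a₀ x) → (∀ x, 0 < θ₀ x) → ∃ σ₀ : ℝ, 0 < σ₀ ∧ ∀ σ : ℝ, 0 < σ → σ < σ₀ → ∀ (T : ℝ) (ρ θ : ℝ → Literature.MathematicalPhysics.KineticTheory.T3 → ℝ) (u : ℝ → Literature.MathematicalPhysics.KineticTheory.T3 → Literature.MathematicalPhysics.KineticTheory.V3), Literature.MathematicalPhysics.KineticTheory.IsHardSphereEulerSolution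 σ T ρ u θ → ∀ Φ : (N : ℕ) → Literature.Analysis.FluidPDE.HardSphereFlow (Literature.Analysis.FluidPDE.Torus.geometry (Fin 3)) (Literature.MathematicalPhysics.KineticTheory.hsDiameter σ N) (N + 1), (∀ N, MeasureTheory.IsProbabilityMeasure (Literature.MathematicalPhysics.KineticTheory.localGibbsLaw σ a₀ u₀ θ₀ N (Φ N))) ∧ (Literature.MathematicalPhysics.KineticTheory.TendstoHydroFieldsAt (fun N => Literature.MathematicalPhysics.KineticTheory.localGibbsLaw σ a₀ u₀ θ₀ N (Φ N)) Φ ρ u θ 0 → ∀ t ∈ Set.Ico 0 T, ∃ a : Literature.MathematicalPhysics.KineticTheory.T3 → ℝ, (∀ N, MeasureTheory.IsProbabilityMeasure (Literature.MathematicalPhysics.KineticTheory.localGibbsLaw σ a (u t) (θ t) N (Φ N))) ∧ (∀ χ : Literature.MathematicalPhysics.KineticTheory.T3 → ℝ, Continuous χ → ∀ δ : ℝ, 0 < δ → ∃ C : ℝ, 0 < C ∧ ∀ N : ℕ, Literature.MathematicalPhysics.KineticTheory.localGibbsLaw σ a (u t) (θ t) N (Φ N) {z | δ < |Literature.MathematicalPhysics.KineticTheory.empiricalDensityField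 z χ - ∫ x, χ x * ρ t x|} ≤ ENNReal.ofReal (C * Real.exp (-(C⁻¹ * (N + 1)))) ∧ Literature.MathematicalPhysics.KineticTheory.localGibbsLaw σ a (u t) (θ t) N (Φ N) {z | δ < ‖Literature.MathematicalPhysics.KineticTheory.empiricalMomentumField z χ - ∫ x, (χ x * ρ t x) • u t x‖} ≤ ENNReal.ofReal (C * Real.exp (-(C⁻¹ * (N + 1)))) ∧ Literature.MathematicalPhysics.KineticTheory.localGibbsLaw σ a (u t) (θ t) N (Φ N) {z | δ < |Literature.MathematicalPhysics.KineticTheory.empiricalEnergyField z χ - ∫ x, χ x * Literature.MathematicalPhysics.KineticTheory.totalEnergyDensity (ρ t x) (u t x) (θ t x)|} ≤ ENNReal.ofReal (C * Real.exp (-(C⁻¹ * (N + 1))))) ∧ Filter.Tendsto (fun N : ℕ => InformationTheory.klDiv ((Φ N).lawAt (Literature.MathematicalPhysics.KineticTheory.localGibbsLaw σ a₀ u₀ θ₀ N (Φ N)) t) (Literature.MathematicalPhysics.KineticTheory.localGibbsLaw σ a (u t) (θ t) N (Φ N)) / ((N : ENNReal) + 1)) Filter.atTop (nhds 0))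

/-- The glue `EntropyMethodTransfer` (item stmt-AtomisticToContinuum-9240) as route `UGibbsSRBRigidity`
declared it until its rev 35, ledger signature verbatim: the entropy target implies the sub-problem
statement. (Since the Statement re-type of 2026-08-16 `_root_.HydrodynamicLimit` denotes the
packing-guarded conjunct; the implication is proved below all the same.) Re-declared here (a
definition, not a cited fact) only to keep `uGibbsSRBRigidity_entropyMethodTransfer_proof` elaborating
under its original statement. -/
def EntropyMethodTransfer : Prop :=
  RelEntropyVanishing → _root_.HydrodynamicLimit

/-- The glue `GronwallU` (item stmt-AtomisticToContinuum-14511, the relative-entropy Gronwall consuming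
only dynamical local limits) as route `UGibbsSRBRigidity` declared it until its rev 35, ledger
signature verbatim: the three primary cruxes imply the entropy target. Re-declared here (a definition,
not a cited fact) only to keep `uGibbsSRBRigidity_assembly_of_gronwallU` /
`uGibbsSRBRigidity_closes_of_gronwallU` elaborating under their original statements; the live route
item is its packing-guarded twin `GronwallUInBand` (stmt-17738). -/
def GronwallU : Prop :=
  URegularLimitsSlaved → URigiditySlaved → GaussianTails → RelEntropyVanishing

end Summit.AtomisticToContinuum.HydrodynamicLimit.Theses.UGibbsSRBRigidity

namespace Summit.AtomisticToContinuum.HydrodynamicLimit.Theorems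

open Summit.AtomisticToContinuum.HydrodynamicLimit.Theses.UGibbsSRBRigidity

/-- **`EntropyMethodTransfer` holds** (route UGibbsSRBRigidity's glue
`RelEntropyVanishing → _root_.HydrodynamicLimit`, stmt-AtomisticToContinuum-9240): the route's
`RelEntropyVanishing` is verbatim the hypothesis of the landed entropy-inequality glue
`hydrodynamicLimit_of_relEntropyVanishing`, whose conclusion, the unguarded Literature statement
`Literature.MathematicalPhysics.KineticTheory.HydrodynamicLimit`, implies the packing-guarded
sub-problem decl `_root_.HydrodynamicLimit` (`HydrodynamicLimit.of_unguarded`; before the Statement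
re-type of 2026-08-16 the two coincided by `abbrev`).
[cite: Yau1991, §2] [cite: KipnisLandim1999, Appendix 1 §8] -/
theorem uGibbsSRBRigidity_entropyMethodTransfer_proof : EntropyMethodTransfer := by
  unfold EntropyMethodTransfer
  intro hRE
  exact _root_.HydrodynamicLimit.of_unguarded (hydrodynamicLimit_of_relEntropyVanishing hRE)

/-- **The Gronwall glue closes the assembly.** If `GronwallU`
(`URegularLimitsSlaved → URigiditySlaved → GaussianTails → RelEntropyVanishing`,
stmt-AtomisticToContinuum-14511) holds, then so does `Assembly`: feed the three primary cruxes to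
the glue and finish with the proved transfer. This is the term
`fun h₁ h₂ h₃ => hT (hG h₁ h₂ h₃)` of the route's (rev-32) `closes` with `hT` discharged.
[cite: OllaVaradhanYau1993, §3] [cite: Yau1991, §2] -/
theorem uGibbsSRBRigidity_assembly_of_gronwallU (hG : GronwallU) : Assembly := by
  unfold Assembly
  intro h₁ h₂ h₃
  exact uGibbsSRBRigidity_entropyMethodTransfer_proof (hG h₁ h₂ h₃)

/-- **What the assembly asks beyond the glue already in the tree**: given the proved transfer,
`Assembly` follows from — and its three antecedents feed exactly — the statement that the three
primary cruxes yield the shared entropy target, i.e. `GronwallU` (since the route's rev 35 the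
deciding theorem `closes` runs over the packing-guarded twins `GronwallUInBand` /
`EntropyMethodTransferInBand`; this unguarded chain reaches the same conclusion through
`uGibbsSRBRigidity_entropyMethodTransfer_proof`). [folklore] -/
theorem uGibbsSRBRigidity_closes_of_gronwallU (h₁ : URegularLimitsSlaved) (h₂ : URigiditySlaved)
    (h₃ : GaussianTails) (hG : GronwallU) : _root_.HydrodynamicLimit :=
  uGibbsSRBRigidity_entropyMethodTransfer_proof (hG h₁ h₂ h₃)

end Summit.AtomisticToContinuum.HydrodynamicLimit.Theorems
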